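import Summits.QuantumFields.BalabanUV.Beta.D1BFx.LandauMultiplierMean
import Summits.QuantumFields.BalabanUV.Beta.D1BFx.BlockMeanBlindness

/-!
# `BalabanUV.Beta.D1BFx.TowerEquationForms` — road «BF-x» for binder row D1, slot (K), dictionary brick B5 (TOWER) + two vocabulary bridges:
# the massive scalar tower `G′ = Ggh n a` as an operator on bounded 0-forms and ITS EQUATION IN `AffineAveraging` CURRENCY
# `codiff₁ (dz (G′f)) = n⁻²·f − (a∕n⁶)·(block sums of G′f)`

`DICT-BRICKS.md` (owner gen 4) brick B5.  The kernel-level dictionary (D-H)/(D-Γ) of K-R1-SPEC v2 §2 verifies the hypotheses of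
`KKTFluctuationUnique.SolvesKKT` — written with `AffineAveraging`'s `dz`, `codiff₁`, `blockSum` — for candidates built from pv23/T2's kernels
(`Ggh`, `Pgt`, …, written with `B6QGQLower276`'s `lapKer`, `B`, `blk`).  THIS FILE supplies the two vocabulary bridges and the one equation every
such verification uses: §1 `codiff₁ ∘ dz` IS the row action of `lapKer` (`codiff₁_dz_eq_tsum_lapKer`); the pv23 block `B (n−1) y` sums ARE
`blockSum n` (`sum_B_eq_blockSum`); §2 [our object] `Gf n a f p := Σ'_q Ggh n a p q · f q` on BOUNDED `f` (absolutely convergent); §3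
**`codiff₁_dz_Gf`**: `codiff₁ (dz (Gf n a f)) p = (n²)⁻¹·f p − a∕(n²·n⁴)·blockSum n (Gf n a f) (blk n p)` — `GhostLeg.tsum_AX_mul_Ggh`
(`(n²(−Δ) + (a∕n⁴)·1_{same block})·G′ = 𝟙`) read on a bounded test function; corollary **`codiff₁_dz_Gf_of_blockSum_eq_zero`**: if every block
sum of `Gf n a g` vanishes (brick B1's situation `g = G′R h`… more precisely the multiplier `G′(R h)`), then `codiff₁ (dz (Gf n a g)) = (n²)⁻¹ • g`.
Oracle: `HOME/b2b-balaban-beta-d1-p2/toy/DICT-TOY-RESULT.md` (the dictionary these bricks serve is exact on tori, two engines).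

HONEST FRAMING (cell contract, verbatim): «discharging `BetaPertH` makes Bałaban's UV stability UNCONDITIONAL — a real constructive-QFT
result; it is NOT the continuum limit and NOT the Clay problem.»  HONEST DEPENDENCY (verbatim): «continuum YM on T⁴ ⇐ BetaPertH ∧ nine
spine estimates (0/9 proved); BetaPertH ⇐ (D1) ∧ (D4) ∧ CAP+tail; G-an2-4 gates asym, D1 and NE2/3/4.»  [folklore] absolutely convergent
lattice bookkeeping; one [our object] data definition (`Gf`) asserting nothing; no `Prop` is minted, nothing is cited, no wall binder is
instantiated; 0 sorry.  NOT summit progress.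
ABSOLUTE RULE (cell, verbatim): «No internally-minted statement may enter as a cited fact. Every hypothesis is either kernel-proved in this
package or a verbatim quotation of a PUBLISHED theorem with page reference. The manuscript(s) under audit are NOT citable for their own
disputed steps — they are the thing under adjudication; programme-internal (2001/route/tribunal) claims are never citable.»
Provenance: road «BF-x» owner gen 4 (prover-b2b-balaban-beta-d1-p2-g4-0), 2026-08-20.
-/

namespace Summit.QuantumFields.BalabanUV.Beta.D1BFx.TowerEquationForms

open Literature.MathematicalPhysics.QuantumFieldTheory.Balaban1983to89
open Literature.MathematicalPhysics.QuantumFieldTheory.Balaban1983to89.Beta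
open ExpKernelCalculus (Site MKer Decays)
open AffineAveraging (Form0 box toSite unitVec dz codiff₁ blockSum)
open AveragingContours (blk)
open B6QGQLower276 (X lapKer lapDir sameBlk AX B mem_B)
open B5Hk103ScalarZd (nbhd tsum_lapKer_mul lapKer_eq_zero_of_not_mem tsum_AX_mul)
open Summit.QuantumFields.BalabanUV.Beta.TameKernelCalculus (Spr Tame Spr.tame)
open GhostLeg (Ggh Ggh_apply spr_Ggh tsum_AX_mul_Ggh AX_pred_apply blk_pred_apply)
open BlockMeanBlindness (tsum_ite_blk_eq_blockSum)

noncomputable section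

variable (n : ℕ) [NeZero n] (a : ℝ)

/-! ## §1 Two vocabulary bridges (pv23 `lapKer`/`B` ↔ `AffineAveraging` `codiff₁∘dz`/`blockSum`) -/

omit [NeZero n] in
/-- [folklore] **`codiff₁ ∘ dz` IS THE ROW ACTION OF THE POSITIVE LAPLACIAN KERNEL**: `codiff₁ (dz f) p = Σ'_r lapKer p r · f r` for EVERY `f`
(`B5Hk103ScalarZd.tsum_lapKer_mul`; `B6QGQLower276.e μ = unitVec μ` definitionally). -/
theorem codiff₁_dz_eq_tsum_lapKer (f : Form0 4 ℝ) (p : Site 4) :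
    codiff₁ (dz f) p = ∑' r : Site 4, lapKer p r * f r := by
  rw [tsum_lapKer_mul]
  simp only [codiff₁, dz, sub_add_cancel]
  refine Finset.sum_congr rfl fun μ _ => ?_
  show f p - f (p - unitVec μ) - (f (p + unitVec μ) - f p) = 2 * f p - f (p + unitVec μ) - f (p - unitVec μ)
  ring

/-- [folklore] The pv23 block label at side `n − 1 + 1 = n` is the cell's `blk n`. -/
theorem blk_pred_eq_blk (p : Site 4) : B6QGQLower276.blk (n - 1) p = blk n p := by
  funext μ
  rw [blk_pred_apply]
  rfl

/-- [folklore] **THE pv23 BLOCK SUM IS `blockSum n`**: `Σ_{p ∈ B (n−1) y} f p = blockSum n f y`. -/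
theorem sum_B_eq_blockSum (f : Form0 4 ℝ) (y : Site 4) : ∑ p ∈ B (n - 1) y, f p = blockSum n f y := by
  classical
  have hn : 1 ≤ n := NeZero.one_le
  rw [← tsum_ite_blk_eq_blockSum hn f y]
  rw [tsum_eq_sum (s := B (n - 1) y) (fun u hu => by
    rw [if_neg]
    intro h
    exact hu (mem_B.2 (by rw [blk_pred_eq_blk]; exact h)))]
  refine Finset.sum_congr rfl fun u hu => ?_
  rw [if_pos]
  rw [← blk_pred_eq_blk]; exact mem_B.1 hu

/-! ## §2 The tower as an operator on bounded 0-forms -/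

/-- [our object] **`G′ f`**: `Gf n a f p := Σ'_q Ggh n a p q · f q` (intended for bounded `f`; the series converges absolutely by the decay of `Ggh`). -/
def Gf (f : Form0 4 ℝ) : Form0 4 ℝ := fun p => ∑' q : Site 4, Ggh n a p q () () * f q

/-- [folklore] Row summability of `q ↦ G′(p,q)·f(q)` for bounded `f`. -/
theorem summable_Ggh_mul (ha : 0 < a) {f : Form0 4 ℝ} {M : ℝ} (hf : ∀ q, |f q| ≤ M) (p : Site 4) :
    Summable fun q : Site 4 => Ggh n a p q () () * f q := by
  obtain ⟨hrow, -, -⟩ := (spr_Ggh n a ha).tame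
  obtain ⟨φ, hφ, hφ0, hφb⟩ := hrow p
  have hM : 0 ≤ M := (abs_nonneg _).trans (hf 0)
  refine Summable.of_norm_bounded (hφ.mul_right M) fun q => ?_
  rw [Real.norm_eq_abs, abs_mul]
  exact mul_le_mul (hφb q () ()) (hf q) (abs_nonneg _) (hφ0 q)

/-! ## §3 The tower equation in form language -/

omit [NeZero n] in
/-- [folklore] The `sameBlk` row sum is a block sum: `Σ'_r 1_{blk r = blk p}·h r = Σ_{r ∈ B (n−1) (blk (n−1) p)} h r`. -/
theorem tsum_sameBlk_mul (p : Site 4) (h : Site 4 → ℝ) :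
    ∑' r : Site 4, sameBlk (n - 1) p r * h r = ∑ r ∈ B (n - 1) (B6QGQLower276.blk (n - 1) p), h r := by
  classical
  rw [tsum_eq_sum (s := B (n - 1) (B6QGQLower276.blk (n - 1) p)) (fun r hr => by
    rw [sameBlk, if_neg (fun h => hr (mem_B.2 h.symm)), zero_mul])]
  refine Finset.sum_congr rfl fun r hr => ?_
  rw [sameBlk, if_pos (mem_B.1 hr).symm, one_mul]

/-- [folklore] **THE LAPLACIAN ROW OF `G′`**: `Σ'_r lapKer p r · G′(r,q) = (n²)⁻¹·(δ_{pq} − (a∕n⁴)·Σ_{r ∈ B(blk p)} G′(r,q))`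
(`tsum_AX_mul_Ggh` with `AX (n−1) a = n²·lapKer + (a∕n⁴)·sameBlk`). -/
theorem tsum_lapKer_mul_Ggh (ha : 0 < a) (p q : Site 4) :
    ∑' r : Site 4, lapKer p r * Ggh n a r q () ()
      = ((n : ℝ) ^ 2)⁻¹ * ((if p = q then 1 else 0) - a / (n : ℝ) ^ 4 * ∑ r ∈ B (n - 1) (B6QGQLower276.blk (n - 1) p), Ggh n a r q () ()) := by
  classical
  have hn0 : (n : ℝ) ≠ 0 := by exact_mod_cast NeZero.ne n
  have hAX := tsum_AX_mul_Ggh n a ha p q () ()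
  have hsub : B (n - 1) (B6QGQLower276.blk (n - 1) p) ⊆ nbhd (n - 1) p := fun r hr => by
    simp only [nbhd, Finset.mem_union]; exact Or.inl (Or.inl hr)
  -- both rows are finitely supported in `nbhd (n−1) p`
  have hL : ∑' r : Site 4, lapKer p r * Ggh n a r q () () = ∑ r ∈ nbhd (n - 1) p, lapKer p r * Ggh n a r q () () :=
    tsum_eq_sum (fun r hr => by rw [lapKer_eq_zero_of_not_mem hr, zero_mul])
  have hS : ∑ r ∈ B (n - 1) (B6QGQLower276.blk (n - 1) p), Ggh n a r q () ()
      = ∑ r ∈ nbhd (n - 1) p, sameBlk (n - 1) p r * Ggh n a r q () () := by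
    rw [← tsum_sameBlk_mul]
    exact tsum_eq_sum (fun r hr => by rw [sameBlk, if_neg (fun h => hr (hsub (mem_B.2 h.symm))), zero_mul])
  rw [tsum_AX_mul] at hAX
  have e : ∑ r ∈ nbhd (n - 1) p, AX (n - 1) a p r * Ggh n a r q () ()
      = (n : ℝ) ^ 2 * ∑ r ∈ nbhd (n - 1) p, lapKer p r * Ggh n a r q () ()
        + a / (n : ℝ) ^ 4 * ∑ r ∈ nbhd (n - 1) p, sameBlk (n - 1) p r * Ggh n a r q () () := by
    rw [Finset.mul_sum, Finset.mul_sum, ← Finset.sum_add_distrib]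
    refine Finset.sum_congr rfl fun r _ => ?_
    rw [AX_pred_apply]; ring
  rw [e] at hAX
  rw [hL, hS, ← hAX]
  have h2 : (n : ℝ) ^ 2 ≠ 0 := pow_ne_zero 2 hn0
  field_simp
  ring

/-- [folklore] **THE TOWER EQUATION IN FORM LANGUAGE (brick B5).**  For every BOUNDED 0-form `f` and every fine site `p`:
`codiff₁ (dz (Gf n a f)) p = (n²)⁻¹·f p − a∕(n²·n⁴)·blockSum n (Gf n a f) (blk n p)`. -/
theorem codiff₁_dz_Gf (ha : 0 < a) {f : Form0 4 ℝ} {M : ℝ} (hf : ∀ q, |f q| ≤ M) (p : Site 4) :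
    codiff₁ (dz (Gf n a f)) p
      = ((n : ℝ) ^ 2)⁻¹ * f p - a / ((n : ℝ) ^ 2 * (n : ℝ) ^ 4) * blockSum n (Gf n a f) (blk n p) := by
  classical
  have hn0 : (n : ℝ) ≠ 0 := by exact_mod_cast NeZero.ne n
  rw [codiff₁_dz_eq_tsum_lapKer]
  -- the Laplacian row is finitely supported: exchange with the `q`-series of `Gf`
  rw [tsum_eq_sum (s := nbhd (n - 1) p) (fun r hr => by rw [lapKer_eq_zero_of_not_mem hr, zero_mul])]
  have hsum : ∀ r ∈ nbhd (n - 1) p, Summable fun q : Site 4 => lapKer p r * (Ggh n a r q () () * f q) :=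
    fun r _ => (summable_Ggh_mul n a ha hf r).mul_left (lapKer p r)
  have e1 : ∑ r ∈ nbhd (n - 1) p, lapKer p r * Gf n a f r
      = ∑' q : Site 4, (∑ r ∈ nbhd (n - 1) p, lapKer p r * Ggh n a r q () ()) * f q := by
    calc ∑ r ∈ nbhd (n - 1) p, lapKer p r * Gf n a f r
        = ∑ r ∈ nbhd (n - 1) p, ∑' q : Site 4, lapKer p r * (Ggh n a r q () () * f q) := by
          refine Finset.sum_congr rfl fun r _ => ?_
          rw [Gf, tsum_mul_left]
      _ = ∑' q : Site 4, ∑ r ∈ nbhd (n - 1) p, lapKer p r * (Ggh n a r q () () * f q) := (Summable.tsum_finsetSum hsum).symm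
      _ = ∑' q : Site 4, (∑ r ∈ nbhd (n - 1) p, lapKer p r * Ggh n a r q () ()) * f q := by
          refine tsum_congr fun q => ?_
          rw [Finset.sum_mul]
          exact Finset.sum_congr rfl fun r _ => by ring
  rw [e1]
  have e2 : ∀ q : Site 4, (∑ r ∈ nbhd (n - 1) p, lapKer p r * Ggh n a r q () ()) * f q
      = ((n : ℝ) ^ 2)⁻¹ * ((if p = q then 1 else 0) * f q)
        - a / ((n : ℝ) ^ 2 * (n : ℝ) ^ 4) * ∑ r ∈ B (n - 1) (B6QGQLower276.blk (n - 1) p), Ggh n a r q () () * f q := by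
    intro q
    have hLq : ∑ r ∈ nbhd (n - 1) p, lapKer p r * Ggh n a r q () () = ∑' r : Site 4, lapKer p r * Ggh n a r q () () :=
      (tsum_eq_sum (s := nbhd (n - 1) p) (fun r hr => by rw [lapKer_eq_zero_of_not_mem hr, zero_mul])).symm
    rw [hLq, tsum_lapKer_mul_Ggh n a ha p q, ← Finset.sum_mul]
    have h2 : (n : ℝ) ^ 2 ≠ 0 := pow_ne_zero 2 hn0
    have h4 : (n : ℝ) ^ 4 ≠ 0 := pow_ne_zero 4 hn0
    field_simp
  simp only [e2]
  have hs1 : Summable fun q : Site 4 => ((n : ℝ) ^ 2)⁻¹ * ((if p = q then 1 else 0) * f q) := by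
    refine (summable_of_ne_finset_zero (s := {p}) fun q hq => ?_).mul_left _
    rw [Finset.mem_singleton] at hq
    rw [if_neg (Ne.symm hq), zero_mul]
  have hs2 : Summable fun q : Site 4 =>
      a / ((n : ℝ) ^ 2 * (n : ℝ) ^ 4) * ∑ r ∈ B (n - 1) (B6QGQLower276.blk (n - 1) p), Ggh n a r q () () * f q :=
    (summable_sum fun r _ => summable_Ggh_mul n a ha hf r).mul_left _
  rw [hs1.tsum_sub hs2, tsum_mul_left, tsum_mul_left]
  rw [tsum_eq_single p (fun q hq => by rw [if_neg (Ne.symm hq), zero_mul]), if_pos rfl, one_mul]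
  rw [Summable.tsum_finsetSum (fun r _ => summable_Ggh_mul n a ha hf r)]
  rw [show (∑ r ∈ B (n - 1) (B6QGQLower276.blk (n - 1) p), ∑' q : Site 4, Ggh n a r q () () * f q)
      = ∑ r ∈ B (n - 1) (B6QGQLower276.blk (n - 1) p), Gf n a f r from rfl,
    sum_B_eq_blockSum, blk_pred_eq_blk]

/-- [folklore] **COROLLARY (the B1 situation).**  If every block sum of `Gf n a g` vanishes (brick B1
`LandauMultiplierMean.sum_blk_tsum_RG_mul_eq_zero` read through the symmetric kernels), then `codiff₁ (dz (Gf n a g)) = (n²)⁻¹ • g`: the tower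
inverts the unit-lattice Laplacian exactly on such data — the identity behind the dictionary's gauge multiplier `wM = −n²·G′R(δℋ_R)`. -/
theorem codiff₁_dz_Gf_of_blockSum_eq_zero (ha : 0 < a) {g : Form0 4 ℝ} {M : ℝ} (hg : ∀ q, |g q| ≤ M)
    (h0 : ∀ y, blockSum n (Gf n a g) y = 0) (p : Site 4) :
    codiff₁ (dz (Gf n a g)) p = ((n : ℝ) ^ 2)⁻¹ * g p := by
  rw [codiff₁_dz_Gf n a ha hg, h0, mul_zero, sub_zero]

end

end Summit.QuantumFields.BalabanUV.Beta.D1BFx.TowerEquationForms
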